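import Summits.RiemannHypothesis.RiemannHypothesis.Theses.JensenLogBand
import Summits.RiemannHypothesis.RiemannHypothesis.Theorems.JensenPolynomialsSqrtLogRange

/-!
# Route `JensenLogBand` (rung J-P (P3), terminal RH-free rung of the Jensen column) — support item `WideBandOfBeyond` PROVED

`WideBandOfBeyond` («every radius function `R` below which `ξ₁⁽ⁿ⁾` has no non-real zero yields the wide hyperbolicity band
`2d + (1+√n)√(2d) ≤ R n`», vocabulary of `Theorems/JensenPolynomialsChainDefs.lean`) is the tree theorem
`KimLee.wideBand_of_beyond` (`Theorems/JensenPolynomialsSqrtLogRange.lean`, p469322, prover-rh-jensen-prover-g6: Jensen chains +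
the Kim–Lee genus-one sector theorem; originally idea-2's kernel-checked sketch `wideBand_of_beyond`), re-stated BY NAME against the
route declaration. One-liner prepared by rh-jensen-eng-2 g4 (HOME/eng-2/logband/WideBandOfBeyond.lean, emulation-verified; handed over
at its DONE 2026-08-26T23:57:50Z) and filed by rh-jensen-eng-5 g5. RH-FREE. WHAT THIS IS NOT: nothing here bears on zeros of `ζ` or
the truth of RH; a hyperbolicity band below a zero-free radius is inside Farmer's class.
-/

noncomputable section
-- D-0017: `Summit.RiemannHypothesis.RiemannHypothesis.…` duplicates the namespace BY DESIGN (single-problem summit).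
set_option linter.dupNamespace false

namespace Summit.RiemannHypothesis.RiemannHypothesis.Theorems.JensenPolynomials.LogBand

open Summit.RiemannHypothesis.RiemannHypothesis.Theorems.JensenPolynomials

/-- **Support item `WideBandOfBeyond` of route «JensenLogBand» (RH-FREE), PROVED** by the tree theorem `KimLee.wideBand_of_beyond`. -/
theorem wideBandOfBeyond_holds :
    Summit.RiemannHypothesis.RiemannHypothesis.Theses.JensenLogBand.WideBandOfBeyond := by
  unfold Summit.RiemannHypothesis.RiemannHypothesis.Theses.JensenLogBand.WideBandOfBeyond
  intro R hR
  exact KimLee.wideBand_of_beyond hR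

end Summit.RiemannHypothesis.RiemannHypothesis.Theorems.JensenPolynomials.LogBand

end
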